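import Literature.AnabelianGeometry.SemiGraphs.Temperoids
import Mathlib.Tactic.Group
import HarnessLib

/-!
# Semi-graphs of anabelioids, §3: proof of the named fact `SlimIffTempSlim` of `Temperoids.lean`

Mochizuki, *Semi-graphs of anabelioids*, Publ. RIMS **42** (2006), §3, Remark 3.4.1 p. 36
[cite: MochizukiSemiAnbd2006, Rmk 3.4.1 p.36]: "a temperoid is slim as a category [cf. §0] if and
only if it is temp-slim as a temperoid", rendered in the statement file
`Literature.AnabelianGeometry.SemiGraphs.Temperoids` (connected case) as the named fact
`SlimIffTempSlim`: for a tempered (Galois-countable) group `Π`, the category `B^temp(Π)` is slim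
(every `B^temp(Π)_A → B^temp(Π)` rigid) iff every open subgroup of `Π` has trivial centraliser.
This proof-only companion discharges it (`slimIffTempSlim_holds`) — the tempered twin of
`bCat_isSlim_iff_isSlimGroup_holds` (`Anabelioids/SlimProofs.lean`):

* (⇐) an automorphism `α` of the forgetful functor `B^temp(Π)_A → B^temp(Π)` acts on each point
  through the pointed coset objects `(Π/K, eK ↦ a)` (`K` open normal below `Stab(a)`), where
  `α(eK) = n_K K`; the cosets are compatible along the projections, so by the COMPLETENESS of the
  tempered group `Π = lim Π/N` (`IsTempered.complete`) some `n` lies in all of them; naturality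
  along right multiplications puts `[n, x]` in every such `K` for `x ∈ Stab(a)`, whence — open
  normal subgroups separating points (`IsTempered.separated`) — `n ∈ Z_Π(Stab(a)) = {1}`;
* (⇒) `z ∈ Z_Π(H)` gives the natural automorphism `b ↦ (g z g⁻¹) · b` (`b ↦ gH` the structure
  map to `A = Π/H`), nontrivial on `(Π/K → Π/H)` for `K ⊆ H` open with `z ∉ K`.

Proof-only: no definitions, nothing of the statement file is restated (the second-countability
hypothesis of the fact, [IUTchI] Rmk 2.5.3 (ii) (E7), is not used).
-/

namespace Literature.AnabelianGeometry.SemiGraphs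

open CategoryTheory CategoryTheory.Limits Topology
open Literature.AlgebraicGeometry.Frobenioids (IsSlim IsSlimGroup)

universe u

variable {G : Type u} [Group G] [TopologicalSpace G] [IsTopologicalGroup G]

omit [IsTopologicalGroup G] in
/-- Equivariance of a morphism of `B^temp(Π)`, pointwise. [folklore] -/
private theorem hom_ρ {X Y : BTemp G} (f : X ⟶ Y) (g : G) (x : X.obj.V) :
    f.hom.hom (X.obj.ρ g x) = Y.obj.ρ g (f.hom.hom x) := by
  have e := ConcreteCategory.congr_hom (f.hom.comm g) x
  simp only [types_comp_apply] at e
  exact e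

/-- (⇐) of `SlimIffTempSlim`: if all open subgroups of the tempered group `Π` have trivial
centraliser, then every forgetful functor `B^temp(Π)_A → B^temp(Π)` is rigid.
[cite: MochizukiSemiAnbd2006, Rmk 3.4.1 p.36] -/
private theorem isSlim_of_isSlimGroup (hG : IsTempered G) (hZ : IsSlimGroup G) :
    IsSlim (BTemp G) := by
  classical
  refine ⟨fun A α => ?_⟩
  letI : MulAction G A.obj.V := Action.instMulAction A.obj
  have hA : ∀ a : A.obj.V, IsOpen (MulAction.stabilizer G a : Set G) := fun a => A.property.2 a
  -- the pointed coset objects `(Π/K, gK ↦ g • a)` over `A`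
  let QV : OpenNormalSubgroup G → BTemp G := fun K =>
    ⟨{ V := G ⧸ K.toSubgroup, ρ := (Action.ofMulAction G (G ⧸ K.toSubgroup)).ρ },
      (temperedAction_quotient_iff hG K.toSubgroup).mpr K.isOpen'⟩
  let Qf : ∀ (a : A.obj.V) (K : OpenNormalSubgroup G),
      K.toSubgroup ≤ MulAction.stabilizer G a → (QV K ⟶ A) := fun a K hK =>
    ObjectProperty.homMk
      { hom := TypeCat.ofHom fun q : G ⧸ K.toSubgroup =>
          Quotient.liftOn' q (fun g : G => g • a) fun g g' h => by
            have h' : g⁻¹ * g' ∈ K.toSubgroup := QuotientGroup.leftRel_apply.mp h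
            have := hK h'
            rw [MulAction.mem_stabilizer_iff, mul_smul, inv_smul_eq_iff] at this
            exact this.symm
        comm := fun x => by
          apply ConcreteCategory.hom_ext
          intro q
          obtain ⟨g, rfl⟩ := QuotientGroup.mk_surjective (q : G ⧸ K.toSubgroup)
          simp only [types_comp_apply, TypeCat.ofHom_apply]
          change Quotient.liftOn' (x • (g : G ⧸ K.toSubgroup) : G ⧸ K.toSubgroup) _ _ =
            x • (g • a)
          rw [MulAction.Quotient.smul_coe, smul_eq_mul]
          exact mul_smul x g a }
  have Qf_mk : ∀ a K hK (g : G),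
      (Qf a K hK).hom.hom (((g : G ⧸ K.toSubgroup) : (QV K).obj.V)) = g • a :=
    fun a K hK g => rfl
  let Q : ∀ (a : A.obj.V) (K : OpenNormalSubgroup G),
      K.toSubgroup ≤ MulAction.stabilizer G a → Over A := fun a K hK => Over.mk (Qf a K hK)
  -- the action of `α` on the cosets of `Q a K`
  let ev : ∀ (a : A.obj.V) (K : OpenNormalSubgroup G),
      K.toSubgroup ≤ MulAction.stabilizer G a → G ⧸ K.toSubgroup → G ⧸ K.toSubgroup :=
    fun a K hK q => (α.hom.app (Q a K hK)).hom.hom q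
  have ev_smul : ∀ a K hK (x : G) (q : G ⧸ K.toSubgroup),
      ev a K hK (x • q) = x • ev a K hK q := fun a K hK x q => by
    have := hom_ρ (α.hom.app (Q a K hK)) x q
    exact this
  -- naturality of `α`, pointwise
  have nat : ∀ {U V : Over A} (k : U ⟶ V) (v : U.left.obj.V),
      (α.hom.app V).hom.hom (k.left.hom.hom v) = k.left.hom.hom ((α.hom.app U).hom.hom v) :=
    fun {U V} k v => by
      have h := congrArg (fun φ : (Over.forget A).obj U ⟶ (Over.forget A).obj V => φ.hom.hom v)
        (α.hom.naturality k)
      exact h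
  -- (1) monotonicity: naturality along the projection `Π/K' → Π/K`
  have mono : ∀ a (K K' : OpenNormalSubgroup G) hK hK' (hle : K'.toSubgroup ≤ K.toSubgroup)
      (n : G), ev a K' hK' ((1 : G) : G ⧸ K'.toSubgroup) = (n : G ⧸ K'.toSubgroup) →
      ev a K hK ((1 : G) : G ⧸ K.toSubgroup) = (n : G ⧸ K.toSubgroup) := by
    intro a K K' hK hK' hle n hn
    let p : Q a K' hK' ⟶ Q a K hK := Over.homMk
      (ObjectProperty.homMk
        { hom := TypeCat.ofHom fun q : G ⧸ K'.toSubgroup =>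
            Quotient.map' id (fun g g' h => by
              have h' : g⁻¹ * g' ∈ K'.toSubgroup := QuotientGroup.leftRel_apply.mp h
              exact QuotientGroup.leftRel_apply.mpr (hle h')) q
          comm := fun x => by
            apply ConcreteCategory.hom_ext
            intro q
            obtain ⟨g, rfl⟩ := QuotientGroup.mk_surjective (q : G ⧸ K'.toSubgroup)
            simp only [types_comp_apply, TypeCat.ofHom_apply]
            change Quotient.map' id _ (x • (g : G ⧸ K'.toSubgroup)) =
              (x • (g : G ⧸ K.toSubgroup) : G ⧸ K.toSubgroup)
            rw [MulAction.Quotient.smul_coe, smul_eq_mul, MulAction.Quotient.smul_coe, smul_eq_mul]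
            rfl })
      (by
        apply ObjectProperty.hom_ext
        apply Action.hom_ext
        apply ConcreteCategory.hom_ext
        intro q
        obtain ⟨g, rfl⟩ := QuotientGroup.mk_surjective (q : G ⧸ K'.toSubgroup)
        rfl)
    have h := nat p ((1 : G) : G ⧸ K'.toSubgroup)
    have hn₁ : (α.hom.app (Q a K' hK')).hom.hom ((1 : G) : G ⧸ K'.toSubgroup) =
        (n : G ⧸ K'.toSubgroup) := hn
    rw [hn₁] at h
    exact h
  -- (2) naturality along right multiplication by `x ∈ Stab(a)`
  have conj : ∀ a (K : OpenNormalSubgroup G) hK (x : G) (hx : x ∈ MulAction.stabilizer G a)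
      (n : G), ev a K hK ((1 : G) : G ⧸ K.toSubgroup) = (n : G ⧸ K.toSubgroup) →
      ev a K hK (x : G ⧸ K.toSubgroup) = ((n * x : G) : G ⧸ K.toSubgroup) := by
    intro a K hK x hx n hn
    let r : Q a K hK ⟶ Q a K hK := Over.homMk
      (ObjectProperty.homMk
        { hom := TypeCat.ofHom fun q : G ⧸ K.toSubgroup =>
            Quotient.map' (fun g : G => g * x) (fun g g' h => by
              have h' : g⁻¹ * g' ∈ K.toSubgroup := QuotientGroup.leftRel_apply.mp h
              apply QuotientGroup.leftRel_apply.mpr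
              have : (g * x)⁻¹ * (g' * x) = x⁻¹ * (g⁻¹ * g') * x := by group
              rw [this]
              exact K.isNormal'.conj_mem' _ h' x) q
          comm := fun y => by
            apply ConcreteCategory.hom_ext
            intro q
            obtain ⟨g, rfl⟩ := QuotientGroup.mk_surjective (q : G ⧸ K.toSubgroup)
            simp only [types_comp_apply, TypeCat.ofHom_apply]
            change Quotient.map' _ _ (y • (g : G ⧸ K.toSubgroup)) =
              (y • ((g * x : G) : G ⧸ K.toSubgroup) : G ⧸ K.toSubgroup)
            rw [MulAction.Quotient.smul_coe, smul_eq_mul, MulAction.Quotient.smul_coe, smul_eq_mul]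
            change (((y * g) * x : G) : G ⧸ K.toSubgroup) = ((y * (g * x) : G) : G ⧸ K.toSubgroup)
            rw [mul_assoc] })
      (by
        apply ObjectProperty.hom_ext
        apply Action.hom_ext
        apply ConcreteCategory.hom_ext
        intro q
        obtain ⟨g, rfl⟩ := QuotientGroup.mk_surjective (q : G ⧸ K.toSubgroup)
        change (Qf a K hK).hom.hom (((g * x : G) : G ⧸ K.toSubgroup) : (QV K).obj.V) =
          (Qf a K hK).hom.hom (((g : G) : G ⧸ K.toSubgroup) : (QV K).obj.V)
        rw [Qf_mk a K hK, Qf_mk a K hK, mul_smul, MulAction.mem_stabilizer_iff.mp hx])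
    have h := nat r ((1 : G) : G ⧸ K.toSubgroup)
    have hn₁ : (α.hom.app (Q a K hK)).hom.hom ((1 : G) : G ⧸ K.toSubgroup) =
        (n : G ⧸ K.toSubgroup) := hn
    rw [hn₁] at h
    have h' : ev a K hK (((1 : G) * x : G) : G ⧸ K.toSubgroup) = ((n * x : G) : G ⧸ K.toSubgroup) := h
    rw [one_mul] at h'
    exact h'
  -- (3) the key step: `α` fixes the base point of every `Q a K`
  have key : ∀ a (K : OpenNormalSubgroup G) hK,
      ev a K hK ((1 : G) : G ⧸ K.toSubgroup) = ((1 : G) : G ⧸ K.toSubgroup) := by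
    intro a K₀ hK₀
    let ι := {K : OpenNormalSubgroup G // K.toSubgroup ≤ MulAction.stabilizer G a}
    let N : ι → Set G := fun K =>
      {n : G | ev a K.1 K.2 ((1 : G) : G ⧸ K.1.toSubgroup) = (n : G ⧸ K.1.toSubgroup)}
    have hNne : ∀ K, (N K).Nonempty := fun K => by
      obtain ⟨n, hn⟩ := QuotientGroup.mk_surjective (ev a K.1 K.2 ((1 : G) : G ⧸ K.1.toSubgroup))
      exact ⟨n, hn.symm⟩
    have hinf : ∀ (K K' : OpenNormalSubgroup G) (g : G), g ∈ (K ⊓ K').toSubgroup →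
        g ∈ K.toSubgroup ∧ g ∈ K'.toSubgroup := fun K K' g hg => Subgroup.mem_inf.mp hg
    -- the compatible family of cosets `M ↦ n_{M ⊓ K₀} M` and, by completeness, an element `n`
    let rep : ι → G := fun K => (hNne K).some
    have hrep : ∀ K : ι, rep K ∈ N K := fun K => (hNne K).some_mem
    let res : OpenNormalSubgroup G → ι := fun M => ⟨M ⊓ K₀, fun g hg => hK₀ (hinf _ _ g hg).2⟩
    obtain ⟨n, hn⟩ := hG.complete (fun M => (rep (res M) : G ⧸ M.toSubgroup)) (by
      intro M M' hMM' g hg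
      -- `rep (res M) M = g M`; monotonicity transports representatives
      have h1 : rep (res M) ∈ N (res M') :=
        mono a (res M').1 (res M).1 (res M').2 (res M).2
          (fun k hk => ⟨hMM' (hinf _ _ k hk).1, (hinf _ _ k hk).2⟩) _ (hrep (res M))
      have h2 : rep (res M') ∈ N (res M') := hrep (res M')
      have h12 : ((rep (res M') : G) : G ⧸ (res M').1.toSubgroup) = rep (res M) :=
        h2.symm.trans h1
      rw [QuotientGroup.eq] at h12 hg ⊢
      have h12' : (rep (res M'))⁻¹ * rep (res M) ∈ M'.toSubgroup := (hinf _ _ _ h12).1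
      have : (rep (res M'))⁻¹ * g = ((rep (res M'))⁻¹ * rep (res M)) * ((rep (res M))⁻¹ * g) := by
        group
      rw [this]
      exact M'.toSubgroup.mul_mem h12' (hMM' hg))
    -- `n` lies in every `N K`
    have hn' : ∀ K : ι, n ∈ N K := fun K => by
      have h1 : rep (res K.1) ∈ N K :=
        mono a K.1 (res K.1).1 K.2 (res K.1).2 (fun k hk => (hinf _ _ k hk).1) _ (hrep (res K.1))
      have h2 : ((rep (res K.1) : G) : G ⧸ K.1.toSubgroup) = (n : G ⧸ K.1.toSubgroup) := hn K.1
      change ev a K.1 K.2 _ = _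
      rw [h1, h2]
    -- `n` commutes with `Stab(a)` modulo every `K`, hence on the nose
    have hcomm : ∀ x ∈ MulAction.stabilizer G a, x * n = n * x := by
      intro x hx
      have hmem : ∀ K : ι, (n * x)⁻¹ * (x * n) ∈ K.1.toSubgroup := fun K => by
        have h1 : ev a K.1 K.2 (x : G ⧸ K.1.toSubgroup) = ((n * x : G) : G ⧸ K.1.toSubgroup) :=
          conj a K.1 K.2 x hx n (hn' K)
        have h2 : ev a K.1 K.2 (x : G ⧸ K.1.toSubgroup) = ((x * n : G) : G ⧸ K.1.toSubgroup) := by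
          have := ev_smul a K.1 K.2 x ((1 : G) : G ⧸ K.1.toSubgroup)
          rw [MulAction.Quotient.smul_coe, smul_eq_mul, mul_one, hn' K,
            MulAction.Quotient.smul_coe, smul_eq_mul] at this
          exact this
        rw [h2] at h1
        exact QuotientGroup.eq.mp h1.symm
      by_contra hne
      have hne' : (n * x)⁻¹ * (x * n) ≠ 1 := by
        intro h
        apply hne
        rw [inv_mul_eq_one] at h
        exact h.symm
      obtain ⟨K₁, hK₁⟩ := hG.separated _ hne'
      exact hK₁ (hinf _ _ _ (hmem ⟨K₁ ⊓ K₀, fun g hg => hK₀ (hinf _ _ g hg).2⟩)).1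
    have hn1 : n = 1 := by
      have hz : n ∈ Subgroup.centralizer ((MulAction.stabilizer G a : Subgroup G) : Set G) := by
        rw [Subgroup.mem_centralizer_iff]
        intro x hx
        exact hcomm x hx
      rw [hZ.centralizer_eq_bot _ (hA a)] at hz
      exact hz
    have := hn' ⟨K₀, hK₀⟩
    rw [hn1] at this
    exact this
  -- (4) conclusion: `α` is the identity on every point of every object over `A`
  apply Iso.ext
  apply NatTrans.ext
  funext U
  rw [Iso.refl_hom, NatTrans.id_app]
  apply ObjectProperty.hom_ext
  apply Action.hom_ext
  apply ConcreteCategory.hom_ext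
  intro (b : U.left.obj.V)
  change (α.hom.app U).hom.hom b = b
  letI : MulAction G U.left.obj.V := Action.instMulAction U.left.obj
  have hb : IsOpen (MulAction.stabilizer G b : Set G) := U.left.property.2 b
  obtain ⟨K₁, -, hK₁⟩ := hG.basis _ (hb.mem_nhds (MulAction.stabilizer G b).one_mem)
  have hKb : K₁.toSubgroup ≤ MulAction.stabilizer G b := fun g hg => hK₁ hg
  let a : A.obj.V := U.hom.hom.hom b
  have hKa : K₁.toSubgroup ≤ MulAction.stabilizer G a := fun g hg => by
    rw [MulAction.mem_stabilizer_iff]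
    have e := hom_ρ U.hom g b
    exact e.symm.trans (congrArg (fun c => U.hom.hom.hom c) (MulAction.mem_stabilizer_iff.mp (hKb hg)))
  -- the orbit map `Π/K₁ → B`, `gK₁ ↦ g • b`, over `A`
  let φ : Q a K₁ hKa ⟶ U := Over.homMk
    (ObjectProperty.homMk
      { hom := TypeCat.ofHom fun q : G ⧸ K₁.toSubgroup =>
          Quotient.liftOn' q (fun g : G => g • b) fun g g' h => by
            have h' : g⁻¹ * g' ∈ K₁.toSubgroup := QuotientGroup.leftRel_apply.mp h
            have := hKb h'
            rw [MulAction.mem_stabilizer_iff, mul_smul, inv_smul_eq_iff] at this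
            exact this.symm
        comm := fun x => by
          apply ConcreteCategory.hom_ext
          intro q
          obtain ⟨g, rfl⟩ := QuotientGroup.mk_surjective (q : G ⧸ K₁.toSubgroup)
          simp only [types_comp_apply, TypeCat.ofHom_apply]
          change Quotient.liftOn' (x • (g : G ⧸ K₁.toSubgroup) : G ⧸ K₁.toSubgroup) _ _ =
            x • (g • b)
          rw [MulAction.Quotient.smul_coe, smul_eq_mul]
          exact mul_smul x g b })
    (by
      apply ObjectProperty.hom_ext
      apply Action.hom_ext
      apply ConcreteCategory.hom_ext
      intro q
      obtain ⟨g, rfl⟩ := QuotientGroup.mk_surjective (q : G ⧸ K₁.toSubgroup)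
      change U.hom.hom.hom (g • b) = g • U.hom.hom.hom b
      exact hom_ρ U.hom g b)
  have h := nat φ ((1 : G) : G ⧸ K₁.toSubgroup)
  change (α.hom.app U).hom.hom ((1 : G) • b) = Quotient.liftOn' (ev a K₁ hKa _) _ _ at h
  rw [key a K₁ hKa, one_smul] at h
  rw [h]
  exact one_smul G b

/-- (⇒) of `SlimIffTempSlim`: if every forgetful functor `B^temp(Π)_A → B^temp(Π)` is rigid, then
open subgroups `H` of the tempered group `Π` have trivial centraliser — `z ∈ Z_Π(H)` defines the
natural automorphism `b ↦ (g z g⁻¹) · b` (`b ↦ gH` the structure map to `A = Π/H`), which moves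
the base point of `(Π/K → Π/H)` for `K ⊆ H` open with `z ∉ K` (open normal subgroups separate
points). [cite: MochizukiSemiAnbd2006, Rmk 3.4.1 p.36] -/
private theorem isSlimGroup_of_isSlim (hG : IsTempered G) (hslim : IsSlim (BTemp G)) :
    IsSlimGroup G := by
  classical
  refine ⟨fun H hH => ?_⟩
  rw [eq_bot_iff]
  intro z hz
  rw [Subgroup.mem_bot]
  by_contra hz1
  -- an open subgroup `K ≤ H` missing `z`
  obtain ⟨N, hN⟩ := hG.separated z hz1
  let K : Subgroup G := N.toSubgroup ⊓ H
  have hK : IsOpen (K : Set G) := N.isOpen'.inter hH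
  have hKH : K ≤ H := fun g hg => (Subgroup.mem_inf.mp hg).2
  have hzK : z ∉ K := fun h => hN (Subgroup.mem_inf.mp h).1
  -- the base object `A = Π/H`
  let A : BTemp G := ⟨{ V := G ⧸ H, ρ := (Action.ofMulAction G (G ⧸ H)).ρ },
    (temperedAction_quotient_iff hG H).mpr hH⟩
  -- the conjugates `θ(gH) = g z g⁻¹` of `z`, well defined since `z` centralises `H`
  let θ : G ⧸ H → G := fun q => q.out * z * q.out⁻¹
  have θ_mk : ∀ g : G, θ (g : G ⧸ H) = g * z * g⁻¹ := fun g => by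
    obtain ⟨h, hh⟩ := QuotientGroup.mk_out_eq_mul H g
    have hc : (h : G) * z = z * h := Subgroup.mem_centralizer_iff.mp hz h h.2
    change (g : G ⧸ H).out * z * ((g : G ⧸ H).out)⁻¹ = g * z * g⁻¹
    rw [hh]
    calc g * ↑h * z * (g * ↑h)⁻¹ = g * (↑h * z) * (↑h)⁻¹ * g⁻¹ := by group
      _ = g * (z * ↑h) * (↑h)⁻¹ * g⁻¹ := by rw [hc]
      _ = g * z * g⁻¹ := by group
  have θ_smul : ∀ (x : G) (q : G ⧸ H), θ (x • q) = x * θ q * x⁻¹ := fun x q => by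
    obtain ⟨g, rfl⟩ := QuotientGroup.mk_surjective q
    rw [MulAction.Quotient.smul_coe, smul_eq_mul, θ_mk, θ_mk]
    group
  have θ_self : ∀ q : G ⧸ H, θ (θ q • q) = θ q := fun q => by
    obtain ⟨g, rfl⟩ := QuotientGroup.mk_surjective q
    rw [θ_mk, MulAction.Quotient.smul_coe, smul_eq_mul, θ_mk]
    group
  have θ_inv_self : ∀ q : G ⧸ H, θ ((θ q)⁻¹ • q) = θ q := fun q => by
    obtain ⟨g, rfl⟩ := QuotientGroup.mk_surjective q
    rw [θ_mk, MulAction.Quotient.smul_coe, smul_eq_mul, θ_mk]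
    group
  -- the structure map of an object over `A`, on points, and its equivariance
  let str : ∀ U : Over A, U.left.obj.V → G ⧸ H := fun U b => U.hom.hom.hom b
  have str_ρ : ∀ (U : Over A) (x : G) (b : U.left.obj.V),
      str U (U.left.obj.ρ x b) = x • str U b := fun U x b => hom_ρ U.hom x b
  have str_map : ∀ {U V : Over A} (k : U ⟶ V) (b : U.left.obj.V),
      str V (k.left.hom.hom b) = str U b := fun {U V} k b => by
    have h := congrArg (fun φ : U.left ⟶ A => φ.hom.hom b) (Over.w k)
    exact h
  -- the permutation `b ↦ θ(f b) • b` of each object over `A`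
  let σ : ∀ U : Over A, U.left.obj.V ≃ U.left.obj.V := fun U =>
    { toFun := fun b => U.left.obj.ρ (θ (str U b)) b
      invFun := fun b => U.left.obj.ρ (θ (str U b))⁻¹ b
      left_inv := fun b => by
        letI : MulAction G U.left.obj.V := Action.instMulAction U.left.obj
        change (θ (str U (θ (str U b) • b)))⁻¹ • θ (str U b) • b = b
        rw [show θ (str U b) • b = U.left.obj.ρ (θ (str U b)) b from rfl, str_ρ, θ_self]
        exact inv_smul_smul (θ (str U b)) b
      right_inv := fun b => by
        letI : MulAction G U.left.obj.V := Action.instMulAction U.left.obj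
        change θ (str U ((θ (str U b))⁻¹ • b)) • (θ (str U b))⁻¹ • b = b
        rw [show (θ (str U b))⁻¹ • b = U.left.obj.ρ (θ (str U b))⁻¹ b from rfl, str_ρ,
          θ_inv_self]
        exact smul_inv_smul (θ (str U b)) b }
  have σ_apply : ∀ (U : Over A) (b : U.left.obj.V), σ U b = U.left.obj.ρ (θ (str U b)) b :=
    fun U b => rfl
  -- ... as a natural automorphism of the forgetful functor `B^temp(Π)_A → B^temp(Π)`
  let ι : ∀ U : Over A, U.left ≅ U.left := fun U =>
    ObjectProperty.isoMk _ (Action.mkIso (σ U).toIso fun x => by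
      apply ConcreteCategory.hom_ext
      intro b
      letI : MulAction G U.left.obj.V := Action.instMulAction U.left.obj
      change σ U (x • b) = x • σ U b
      rw [σ_apply, σ_apply, show x • b = U.left.obj.ρ x b from rfl, str_ρ, θ_smul]
      change (x * θ (str U b) * x⁻¹) • x • b = x • θ (str U b) • b
      rw [smul_smul, smul_smul, inv_mul_cancel_right])
  let α : Over.forget A ≅ Over.forget A := NatIso.ofComponents (fun U => ι U) fun {U V} k => by
    apply ObjectProperty.hom_ext
    apply Action.hom_ext
    apply ConcreteCategory.hom_ext
    intro b
    change σ V (k.left.hom.hom b) = k.left.hom.hom (σ U b)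
    rw [σ_apply, σ_apply, str_map, hom_ρ]
  -- rigidity: `α` is the identity, in particular on the base point of `Π/K → Π/H`
  have hrig := hslim.isRigid_forget A α
  let QK : BTemp G := ⟨{ V := G ⧸ K, ρ := (Action.ofMulAction G (G ⧸ K)).ρ },
    (temperedAction_quotient_iff hG K).mpr hK⟩
  let π : QK ⟶ A := ObjectProperty.homMk
    { hom := TypeCat.ofHom fun q : G ⧸ K =>
        Quotient.map' id (fun g g' h => by
          have h' : g⁻¹ * g' ∈ K := QuotientGroup.leftRel_apply.mp h
          exact QuotientGroup.leftRel_apply.mpr (hKH h')) q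
      comm := fun x => by
        apply ConcreteCategory.hom_ext
        intro q
        obtain ⟨g, rfl⟩ := QuotientGroup.mk_surjective (q : G ⧸ K)
        simp only [types_comp_apply, TypeCat.ofHom_apply]
        change Quotient.map' id _ (x • (g : G ⧸ K)) = (x • (g : G ⧸ H) : G ⧸ H)
        rw [MulAction.Quotient.smul_coe, smul_eq_mul, MulAction.Quotient.smul_coe, smul_eq_mul]
        rfl }
  have h := congrArg (fun β : Over.forget A ≅ Over.forget A =>
    (β.hom.app (Over.mk π)).hom.hom ((1 : G) : G ⧸ K)) hrig
  change (θ ((1 : G) : G ⧸ H) • ((1 : G) : G ⧸ K) : G ⧸ K) = ((1 : G) : G ⧸ K) at h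
  rw [θ_mk, one_mul, inv_one, mul_one, MulAction.Quotient.smul_coe, smul_eq_mul, mul_one,
    QuotientGroup.eq, mul_one] at h
  exact hzK (inv_mem_iff.mp h)

/-- NAMED FACT `SlimIffTempSlim` ([SemiAnbd] Remark 3.4.1 p. 36), PROVED: for a tempered group
`Π`, the connected temperoid `B^temp(Π)` is slim (all `B^temp(Π)_A → B^temp(Π)` rigid) iff every
open subgroup of `Π` has trivial centraliser. [cite: MochizukiSemiAnbd2006, Rmk 3.4.1 p.36] -/
theorem slimIffTempSlim_holds : SlimIffTempSlim.{u} := by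
  intro G _ _ _ _ hG
  exact ⟨isSlimGroup_of_isSlim hG, isSlim_of_isSlimGroup hG⟩

end Literature.AnabelianGeometry.SemiGraphs
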